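import Literature.IUT.HodgeTheaters.InitialThetaData
import Literature.IUT.HodgeTheaters.PuncturedEllipticCoveringsRmk121Proofs
import Literature.IUT.HodgeTheaters.PuncturedEllipticCoveringsCor12Respd
import HarnessLib

/-!
# [IUTchI] Cor. 1.2 / Rmk. 1.2.1 at the initial Θ-datum (Def. 3.1 (d), (f)): the law `[Π_X : Π_X̲] = l`
# discharged — proofs only

S. Mochizuki, *Inter-universal Teichmüller theory I*, kurims manuscript (May 2020), §1 Cor. 1.2 / Rmk. 1.2.1
(pp. 39–40) read at Def. 3.1 (d), (f) (pp. 62–63: "`X̲_K` … of type `(1, l-tors)`", "the data `(X_K, C̲_K, ε̲)`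
determines … `Π_{X̲→_K} ⊆ Π_{C̲→_K} ⊆ Π_{C_F}`") [claim: Mochizuki2012, status: disputed].

`Proofs` companion (theorems only; no definitions, no instances, nothing restated) JOINING the abc-iut-L5-d4 kernels
for node `IUTchI:Cor1.2` (`PuncturedEllipticCoveringsXbarRecovery` p429979, `…CuspTransport` p431538,
`…Rmk121Proofs` p432845, `…Cor12Assembly` p432882, `…Cor12Respd` p433266) with abc-iut-L5-t2's
`InitialThetaData` (`ThetaGeometry`, Def. 3.1 (b)(d)(f)): the `K`-level §1 datum of an initial Θ-datum is
`D.geom.pe : PuncturedEllipticData`, and the law `[Π_X : Π_X̲] = l` that the kernels take as the hypothesis `hX`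
IS the field `ThetaGeometry.PiXbar_relIndex` (with `ThetaGeometry.pe_l`).  Hence, AT THE GENUINE DATUM:
* `InitialThetaData.pe_relIndex_piXbar_piX` — `hX` holds for `D.geom.pe`; `pe_card_cusp` — `#Cusp(X̲_K) = l`
  given a cusp interface (abc-iut-L5-t1 `CuspGalois.card_cusp`);
* `InitialThetaData.pe_piXarrow_sup_H_eq_piXbar` / `pe_piCarrow_sup_H_eq_piCbar` — `Π_X̲ = Π_{X̲→}·H`,
  `Π_C̲ = Π_{C̲→}·H` given the printed claims of p. 38 (`ArrowCoveringClaims`) and the cusp interface (`CuspGalois`);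
* `InitialThetaData.pe_rmk121` — Remark 1.2.1 (`Rmk121`) for `D.geom.pe` given `ArrowCoveringClaims` + `CuspGalois`;
* `InitialThetaData.pe_characteristicNatureOfCoverings_of_anabelian` — the typed Cor. 1.2 between the `K`-level data
  of two initial Θ-data from the printed claims, the cusp interfaces, the printed ramification of `ε⁰` (GAP-LEDGER
  G-L5d4g6-1) and the printed-shape anabelian inputs `hcore`/`hLem45`/`hcoreC`/`hLem45C` ([AbsTopI] Prop. 2.3 (ii),
  Thm. 2.6 (v)(vi), Lem. 4.5 + Rmk. 1.2.2 (ii); [AbsTopII] Cor. 3.3 (i)(ii)) — hypotheses, never asserted.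
No statement of the paper is strengthened; no side is taken on [IUTchIII] Cor. 3.12; typed ≠ discharged for
the anabelian inputs.
-/

namespace Literature.IUT.HodgeTheaters

namespace InitialThetaData

open scoped Pointwise
open Literature.AnabelianGeometry.AbsoluteAnabelian

universe u v w u' v'

variable {F : Type u} {K : Type v} {Fbar : Type w} [Field F] [NumberField F] [Field K] [NumberField K]
  [Algebra F K] [Field Fbar] [Algebra F Fbar] [Algebra K Fbar]
  {E : WeierstrassCurve F} [E.IsElliptic] {l : ℕ} {Pb : BadPlacePredicates K}
  (D : InitialThetaData F K Fbar E l Pb)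

/-- **The law `[Π_X : Π_X̲] = l` at the datum**: for the `K`-level §1 datum `D.geom.pe` of an initial Θ-datum,
`[Π_{X_K} : Π_{X̲_K}] = l` is Def. 3.1 (d) "`X̲_K` of type `(1, l-tors)`" (`ThetaGeometry.PiXbar_relIndex`, `pe_l`).
([IUTchI] Def 3.1 (d) p.62) [claim: Mochizuki2012, status: disputed] -/
theorem pe_relIndex_piXbar_piX : D.geom.pe.PiXbar.relIndex D.geom.pe.PiX = D.geom.pe.l :=
  D.geom.PiXbar_relIndex.trans D.geom.pe_l.symm

/-- **`#Cusp(X̲_K) = l` at the datum**: with a cusp interface `C` for `D.geom.pe`, the number of cusps of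
`X̲_K` is `[Π_{X_K} : Π_{X̲_K}]` (abc-iut-L5-t1 `CuspGalois.card_cusp`) `= l` (Def. 3.1 (d)) — the `hcard` of
abc-iut-L5-d4's `…Splitting` kernels and of the `𝔽_l^{⋊±}`-symmetry consumers of §6.
([IUTchI] Def 3.1 (d) p.62) [claim: Mochizuki2012, status: disputed] -/
theorem pe_card_cusp (C : D.geom.pe.CuspGalois) : Nat.card D.geom.pe.Cusp = l :=
  C.card_cusp.trans D.geom.PiXbar_relIndex

/-- **`Π_X̲ = Π_{X̲→} · H` at the datum** (Cor. 1.2 proof p. 39), `H = Ker(Δ_X ↠ Δ_X^{ab} ⊗ ℤ/lℤ)`, given the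
printed claims of p. 38 and the cusp interface of `D.geom.pe`. ([IUTchI] Cor 1.2 p.39) [claim: Mochizuki2012, status: disputed] -/
theorem pe_piXarrow_sup_H_eq_piXbar (h : D.geom.pe.ArrowCoveringClaims) (C : D.geom.pe.CuspGalois) :
    D.geom.pe.piXarrow ⊔ (⁅D.geom.pe.PiX ⊓ D.geom.pe.DeltaC, D.geom.pe.PiX ⊓ D.geom.pe.DeltaC⁆ ⊔
      Subgroup.closure ((fun y : D.geom.pe.PiC => y ^ D.geom.pe.l) ''
        (D.geom.pe.PiX ⊓ D.geom.pe.DeltaC : Set D.geom.pe.PiC))).topologicalClosure = D.geom.pe.PiXbar :=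
  h.piXarrow_sup_H_eq_piXbar C D.pe_relIndex_piXbar_piX

/-- **`Π_C̲ = Π_{C̲→} · H` at the datum** (Cor. 1.2 proof p. 39, resp'd case), given the printed claims of p. 38
and the cusp interface of `D.geom.pe`. ([IUTchI] Cor 1.2 p.39) [claim: Mochizuki2012, status: disputed] -/
theorem pe_piCarrow_sup_H_eq_piCbar (h : D.geom.pe.ArrowCoveringClaims) (C : D.geom.pe.CuspGalois) :
    D.geom.pe.piCarrow ⊔ (⁅D.geom.pe.PiX ⊓ D.geom.pe.DeltaC, D.geom.pe.PiX ⊓ D.geom.pe.DeltaC⁆ ⊔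
      Subgroup.closure ((fun y : D.geom.pe.PiC => y ^ D.geom.pe.l) ''
        (D.geom.pe.PiX ⊓ D.geom.pe.DeltaC : Set D.geom.pe.PiC))).topologicalClosure = D.geom.pe.PiCbar :=
  h.piCarrow_sup_H_eq_piCbar C D.pe_relIndex_piXbar_piX

/-- **Remark 1.2.1 at the datum**: `Aut_K(X̲→_K) = Gal(X̲→_K/C̲_K)`, `Aut_K(C̲→_K) = Gal(C̲→_K/C̲_K)` (group level:
the typed `Rmk121` of the `K`-level datum) given its printed claims of p. 38 and its cusp interface — the law
`[Π_X : Π_X̲] = l` is Def. 3.1 (d). ([IUTchI] Rmk 1.2.1 p.40) [claim: Mochizuki2012, status: disputed] -/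
theorem pe_rmk121 (h : D.geom.pe.ArrowCoveringClaims) (C : D.geom.pe.CuspGalois) : D.geom.pe.Rmk121 :=
  h.rmk121 C D.pe_relIndex_piXbar_piX

variable {F' : Type u'} {K' : Type v'} [Field F'] [NumberField F'] [Field K'] [NumberField K'] [Algebra F' K']
  {Fbar' : Type w} [Field Fbar'] [Algebra F' Fbar'] [Algebra K' Fbar']
  {E' : WeierstrassCurve F'} [E'.IsElliptic] {l' : ℕ} {Pb' : BadPlacePredicates K'}
  (D' : InitialThetaData F' K' Fbar' E' l' Pb')

/-- **[IUTchI] Cor. 1.2 between the `K`-level data of two initial Θ-data**, from the printed claims of p. 38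
(`ArrowCoveringClaims`), the cusp interfaces (`CuspGalois`), the printed ramification of `ε⁰` in `X̲→ → X̲`
(`¬ I_{ε⁰} ⊆ Π_{X̲→}`, GAP-LEDGER G-L5d4g6-1) and — as hypotheses, never asserted — the printed-shape anabelian
inputs: `hcore`/`hcoreC` (every bicontinuous isomorphism of `Π_{X̲→}`'s, resp. `Π_{C̲→}`'s, extends to a
bicontinuous isomorphism of the cores `Π_C` carrying `Δ_X`, `Δ_C` along: slimness [AbsTopI] Prop. 2.3 (ii) +
Thm. 2.6 (v)(vi) + [AbsTopII] Cor. 3.3 (i)(ii)) and `hLem45`/`hLem45C` (cuspidal decomposition groups correspond: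
[AbsTopI] Lem. 4.5 + Rmk. 1.2.2 (ii), for `X̲` and for the orbicurve `C̲`).  The law `[Π_X : Π_X̲] = l` of the
abstract kernels is DISCHARGED here by Def. 3.1 (d). ([IUTchI] Cor 1.2 p.39) [claim: Mochizuki2012, status: disputed] -/
theorem pe_characteristicNatureOfCoverings_of_anabelian (h : D.geom.pe.ArrowCoveringClaims)
    (h' : D'.geom.pe.ArrowCoveringClaims) (C : D.geom.pe.CuspGalois) (C' : D'.geom.pe.CuspGalois)
    (h0 : ¬ D.geom.pe.inertia D.geom.pe.ε0 ≤ D.geom.pe.piXarrow)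
    (h0' : ¬ D'.geom.pe.inertia D'.geom.pe.ε0 ≤ D'.geom.pe.piXarrow)
    (hcore : ∀ φ : D.geom.pe.piXarrow ≃* D'.geom.pe.piXarrow, Continuous φ → Continuous φ.symm →
      ∃ Θ : D.geom.pe.PiC ≃* D'.geom.pe.PiC, Continuous Θ ∧ Continuous Θ.symm ∧
        (∀ x : D.geom.pe.piXarrow, Θ (x : D.geom.pe.PiC) = (φ x : D'.geom.pe.PiC)) ∧
        (D.geom.pe.PiX ⊓ D.geom.pe.DeltaC).map Θ.toMonoidHom = D'.geom.pe.PiX ⊓ D'.geom.pe.DeltaC ∧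
        D.geom.pe.DeltaC.map Θ.toMonoidHom = D'.geom.pe.DeltaC)
    (hLem45 : ∀ Θ : D.geom.pe.PiC ≃* D'.geom.pe.PiC, Continuous Θ → Continuous Θ.symm →
      D.geom.pe.PiXbar.map Θ.toMonoidHom = D'.geom.pe.PiXbar →
        (∀ x : D.geom.pe.Cusp, ∃ x' : D'.geom.pe.Cusp, ∃ t' ∈ D'.geom.pe.PiXbar,
          (D.geom.pe.decomp x).map Θ.toMonoidHom = MulAut.conj t' • D'.geom.pe.decomp x') ∧
        (∀ x' : D'.geom.pe.Cusp, ∃ x : D.geom.pe.Cusp, ∃ t' ∈ D'.geom.pe.PiXbar,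
          (D.geom.pe.decomp x).map Θ.toMonoidHom = MulAut.conj t' • D'.geom.pe.decomp x'))
    (hcoreC : ∀ ψ : D.geom.pe.piCarrow ≃* D'.geom.pe.piCarrow, Continuous ψ → Continuous ψ.symm →
      ∃ Θ : D.geom.pe.PiC ≃* D'.geom.pe.PiC, Continuous Θ ∧ Continuous Θ.symm ∧
        (∀ x : D.geom.pe.piCarrow, Θ (x : D.geom.pe.PiC) = (ψ x : D'.geom.pe.PiC)) ∧
        (D.geom.pe.PiX ⊓ D.geom.pe.DeltaC).map Θ.toMonoidHom = D'.geom.pe.PiX ⊓ D'.geom.pe.DeltaC ∧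
        D.geom.pe.DeltaC.map Θ.toMonoidHom = D'.geom.pe.DeltaC)
    (hLem45C : ∀ Θ : D.geom.pe.PiC ≃* D'.geom.pe.PiC, Continuous Θ → Continuous Θ.symm →
      D.geom.pe.PiCbar.map Θ.toMonoidHom = D'.geom.pe.PiCbar →
        (∀ x : D.geom.pe.Cusp, x ≠ D.geom.pe.ε0 → ∃ x' : D'.geom.pe.Cusp, x' ≠ D'.geom.pe.ε0 ∧
          ∃ t' ∈ D'.geom.pe.PiCbar,
            (D.geom.pe.decomp x).map Θ.toMonoidHom = MulAut.conj t' • D'.geom.pe.decomp x') ∧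
        (∀ x' : D'.geom.pe.Cusp, x' ≠ D'.geom.pe.ε0 → ∃ x : D.geom.pe.Cusp, x ≠ D.geom.pe.ε0 ∧
          ∃ t' ∈ D'.geom.pe.PiCbar,
            (D.geom.pe.decomp x).map Θ.toMonoidHom = MulAut.conj t' • D'.geom.pe.decomp x')) :
    D.geom.pe.CharacteristicNatureOfCoverings D'.geom.pe :=
  PuncturedEllipticData.characteristicNatureOfCoverings_of_anabelian' h h' C C' D.pe_relIndex_piXbar_piX
    D'.pe_relIndex_piXbar_piX h0 h0' hcore hLem45 hcoreC hLem45C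

end InitialThetaData

end Literature.IUT.HodgeTheaters

-- enqueue re-land 2026-08-26T10:03:14Z (stranded accept p434154, no content change; abc-iut-L5-d1 g5, CERT-L5 v0.4 parent)
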